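import Mathlib

/-!
# Stub `stub_tangencySets` (line `Sketch`, crux `LevelOneGL2Designs`, stmt-MatrixMultiplication-14080):
the quadratic-residue ("Paley") lift — wall-breaker axis 4/12, *Hermitian unital constructions*

The stub asks for `c > 0` and unboundedly many primes `p` with a set `S` of point–line flags
`(x_f, ℓ_f) ∈ 𝔽_p² × 𝔽_p²` (the line of `ℓ` being `{v : ⟨v, ℓ⟩ = 1}`) of size `≥ c·p^{3/2}` such that
`⟨x_f, ℓ_{f'}⟩ = 1 ↔ f = f'` — an induced matching in the point–line incidence graph of `AG(2,p)`
(a strong representative system), lines through the origin excluded.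

Over a field of square order `q = q₀²` the Hermitian unital gives `q^{3/2} − q^{1/2}` such flags.  Over a
PRIME field the unital mechanism survives only as the quadratic-residue lift (Szőnyi 1992; Hunter–
Pohoata–Verstraëte–Zhang 2026, Prop. 2.1): if `I ⊆ 𝔽_p` has no non-zero square difference, the points
of the parabolas `x + y² = t`, `t ∈ I`, each paired with the parabola tangent
`{(u,v) : u + 2yv = x + 2y²}`, form an induced matching of size `p·|I|`.  This file proves that lift
in the stub's exact format (`paley_lift`, losing the `≤ p` points whose tangent passes through the
origin) and the resulting reduction of the stub to large Paley cocliques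
(`stub_tangencySets_of_paleyCocliques`: cocliques of size `≥ c√p` in `𝔽_p` for unboundedly many
primes give the stub verbatim).  The residual hypothesis sits exactly at the square-root barrier for
Paley graphs (`ω(G_p) ≤ √p`, Hanson–Petridis `≤ √(p/2) + 1`); see AXIS.md of this seat.

All statements are elementary; no new definitions.
-/

set_option linter.dupNamespace false

namespace Summit.MatrixMultiplication.MatrixMultiplication.Theorems.LevelOneGL2Designs.TangencyPaley

open Finset

variable {p : ℕ} [Fact p.Prime]

/-- The dot product of the point `(x, y)` with the normalised tangent vector
`(x' + 2y'²)⁻¹ • (1, 2y')` of the flag at `(x', y')`. [elementary] -/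
theorem dotProduct_flag (x y x' y' : ZMod p) :
    dotProduct ![x, y] ((x' + 2 * y' ^ 2)⁻¹ • ![1, 2 * y']) =
      (x' + 2 * y' ^ 2)⁻¹ * (x + 2 * y * y') := by
  simp [dotProduct, Fin.sum_univ_two]
  ring

/-- **Key identity of the lift.**  If `(x, y)` lies on the tangent of the flag at `(x', y')`, i.e.
`x + 2yy' = x' + 2y'²`, then the parabola parameters differ by a square:
`(x + y²) − (x' + y'²) = (y − y')²`. [elementary] -/
theorem param_sub_param_eq_sq {x y x' y' : ZMod p} (h : x + 2 * y * y' = x' + 2 * y' ^ 2) :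
    (x + y ^ 2) - (x' + y' ^ 2) = (y - y') ^ 2 := by
  linear_combination h

/-- **The Paley lift** (Szőnyi 1992; Hunter–Pohoata–Verstraëte–Zhang 2026, Prop. 2.1), in the format
of `stub_tangencySets`.  If `I ⊆ 𝔽_p` has no non-zero square difference, then the flags
`((x,y), (x+2y²)⁻¹·(1,2y))` over the points of the parabolas `x + y² ∈ I` with `x + 2y² ≠ 0` form an
induced point–line matching `S` with `p·|I| ≤ |S| + p`. [cite: HunterPohoataVerstraeteZhang2026, Prop. 2.1; Szonyi1992LargeMinimalBlockingSets] -/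
theorem paley_lift (I : Finset (ZMod p))
    (hI : ∀ a ∈ I, ∀ b ∈ I, ∀ z : ZMod p, a - b = z ^ 2 → z = 0) :
    ∃ S : Finset ((Fin 2 → ZMod p) × (Fin 2 → ZMod p)),
      p * I.card ≤ S.card + p ∧
      ∀ f ∈ S, ∀ f' ∈ S, (dotProduct f.1 f'.2 = 1 ↔ f = f') := by
  classical
  -- the flag map
  let F : ZMod p × ZMod p → (Fin 2 → ZMod p) × (Fin 2 → ZMod p) :=
    fun q => (![q.1, q.2], (q.1 + 2 * q.2 ^ 2)⁻¹ • ![1, 2 * q.2])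
  have hF : Function.Injective F := by
    intro q q' h
    have h1 : (F q).1 0 = (F q').1 0 := by rw [h]
    have h2 : (F q).1 1 = (F q').1 1 := by rw [h]
    simp only [F, Matrix.cons_val_zero, Matrix.cons_val_one] at h1 h2
    exact Prod.ext h1 h2
  -- all points of the parabolas `x + y² ∈ I`
  let A : Finset (ZMod p × ZMod p) := univ.filter fun q => q.1 + q.2 ^ 2 ∈ I
  -- the points whose tangent passes through the origin
  let B : Finset (ZMod p × ZMod p) := univ.filter fun q => q.1 + 2 * q.2 ^ 2 = 0
  have hA : A.card = p * I.card := by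
    have : A = (univ ×ˢ I).image fun q : ZMod p × ZMod p => (q.2 - q.1 ^ 2, q.1) := by
      ext q
      simp only [A, mem_filter, mem_univ, true_and, mem_image, mem_product]
      constructor
      · intro hq
        exact ⟨(q.2, q.1 + q.2 ^ 2), hq, by ext <;> simp⟩
      · rintro ⟨r, hr, rfl⟩
        simpa using hr
    rw [this, card_image_of_injective, card_product, card_univ, ZMod.card]
    intro r r' h
    simp only [Prod.mk.injEq] at h
    obtain ⟨h1, h2⟩ := h
    refine Prod.ext h2 ?_
    rw [h2] at h1
    simpa using h1
  have hB : B.card ≤ p := by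
    have : B ⊆ (univ : Finset (ZMod p)).image fun y => (-(2 * y ^ 2), y) := by
      intro q hq
      simp only [B, mem_filter, mem_univ, true_and] at hq
      simp only [mem_image, mem_univ, true_and]
      exact ⟨q.2, by ext <;> simp [eq_neg_of_add_eq_zero_left hq]⟩
    calc B.card ≤ ((univ : Finset (ZMod p)).image fun y => (-(2 * y ^ 2), y)).card :=
          card_le_card this
      _ ≤ (univ : Finset (ZMod p)).card := card_image_le
      _ = p := by rw [card_univ, ZMod.card]
  refine ⟨(A \ B).image F, ?_, ?_⟩
  · rw [card_image_of_injective _ hF]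
    calc p * I.card = A.card := hA.symm
      _ ≤ (A \ B).card + B.card := card_le_card_sdiff_add_card
      _ ≤ (A \ B).card + p := Nat.add_le_add_left hB _
  · intro f hf f' hf'
    simp only [mem_image, mem_sdiff, A, B, mem_filter, mem_univ, true_and] at hf hf'
    obtain ⟨⟨x, y⟩, ⟨hxy, hxy0⟩, rfl⟩ := hf
    obtain ⟨⟨x', y'⟩, ⟨hxy', hxy0'⟩, rfl⟩ := hf'
    simp only [F]
    rw [dotProduct_flag]
    constructor
    · intro h
      have h' : x + 2 * y * y' = x' + 2 * y' ^ 2 := by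
        have := congrArg ((x' + 2 * y' ^ 2) * ·) h
        simpa [← mul_assoc, mul_inv_cancel₀ hxy0'] using this
      have hsq := param_sub_param_eq_sq h'
      have hy : y = y' := sub_eq_zero.mp (hI _ hxy _ hxy' _ hsq)
      subst hy
      have hx : x = x' := by linear_combination h'
      subst hx
      rfl
    · intro h
      have h1 := congrArg (fun f : (Fin 2 → ZMod p) × (Fin 2 → ZMod p) => f.1 0) h
      have h2 := congrArg (fun f : (Fin 2 → ZMod p) × (Fin 2 → ZMod p) => f.1 1) h
      simp only [Matrix.cons_val_zero, Matrix.cons_val_one] at h1 h2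
      subst h1 h2
      rw [show x + 2 * y * y = x + 2 * y ^ 2 by ring]
      exact inv_mul_cancel₀ hxy0


/-- `p^{3/2} = p · √p` for a natural number `p`. [elementary] -/
theorem rpow_three_halves (n : ℕ) : (n : ℝ) ^ (3 / 2 : ℝ) = n * Real.sqrt n := by
  rw [show (3 / 2 : ℝ) = 1 + 1 / 2 by norm_num, Real.sqrt_eq_rpow]
  rcases Nat.eq_zero_or_pos n with h | h
  · subst h
    rw [Nat.cast_zero, Real.zero_rpow (by norm_num), Real.zero_rpow (by norm_num), mul_zero]
  · rw [Real.rpow_add (by exact_mod_cast h), Real.rpow_one]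

omit [Fact p.Prime] in
/-- **Reduction of `stub_tangencySets` to large Paley cocliques.**  If for some `c > 0` there are
unboundedly many primes `p` carrying a set `I ⊆ 𝔽_p` of size `≥ c·√p` without non-zero square
differences (a coclique of the Paley graph when `p ≡ 1 (mod 4)`), then the signature of
`stub_tangencySets` holds (with constant `c/2`).  The hypothesis is the square-root barrier for Paley
graphs of prime order: `|I| ≤ √p` always (Delsarte–Hoffman), `≤ √(p/2) + 1` (Hanson–Petridis 2021),
`= √p` exactly over square fields (the unital case); no `c·√p` cocliques over prime fields are known.
[cite: HunterPohoataVerstraeteZhang2026, Prop. 2.1 and §10] -/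
theorem stub_tangencySets_of_paleyCocliques
    (h : ∃ c : ℝ, 0 < c ∧ ∀ p₀ : ℕ, ∃ (p : ℕ) (_ : Fact p.Prime), p₀ ≤ p ∧
      ∃ I : Finset (ZMod p), c * Real.sqrt p ≤ I.card ∧
        ∀ a ∈ I, ∀ b ∈ I, ∀ z : ZMod p, a - b = z ^ 2 → z = 0) :
    ∃ c : ℝ, 0 < c ∧ ∀ p₀ : ℕ, ∃ (p : ℕ) (_ : Fact p.Prime), p₀ ≤ p ∧
      ∃ S : Finset ((Fin 2 → ZMod p) × (Fin 2 → ZMod p)),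
        c * (p : ℝ) ^ (3 / 2 : ℝ) ≤ S.card ∧
        ∀ f ∈ S, ∀ f' ∈ S, (dotProduct f.1 f'.2 = 1 ↔ f = f') := by
  obtain ⟨c, hc, h⟩ := h
  refine ⟨c / 2, by positivity, fun p₀ => ?_⟩
  obtain ⟨p, hp, hp₀, I, hI, hcoc⟩ := h (max p₀ ⌈4 / c ^ 2⌉₊)
  obtain ⟨S, hS, hmatch⟩ := paley_lift I hcoc
  refine ⟨p, hp, le_of_max_le_left hp₀, S, ?_, hmatch⟩
  have hp4 : 4 / c ^ 2 ≤ (p : ℝ) := (Nat.ceil_le.mp (le_of_max_le_right hp₀))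
  have hppos : (0 : ℝ) ≤ p := Nat.cast_nonneg p
  have hsqrt : 2 / c ≤ Real.sqrt p := by
    apply Real.le_sqrt_of_sq_le
    calc (2 / c) ^ 2 = (4 / c ^ 2 : ℝ) := by ring
      _ ≤ (p : ℝ) := hp4
  -- `p ≤ (c/2) · p · √p`
  have hlin : (p : ℝ) ≤ c / 2 * (p * Real.sqrt p) := by
    have : (1 : ℝ) ≤ c / 2 * Real.sqrt p := by
      have := mul_le_mul_of_nonneg_left hsqrt (le_of_lt (half_pos hc))
      calc (1 : ℝ) = c / 2 * (2 / c) := by field_simp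
        _ ≤ c / 2 * Real.sqrt p := this
    calc (p : ℝ) = p * 1 := (mul_one _).symm
      _ ≤ p * (c / 2 * Real.sqrt p) := mul_le_mul_of_nonneg_left this hppos
      _ = c / 2 * (p * Real.sqrt p) := by ring
  have hS' : (p : ℝ) * I.card ≤ S.card + p := by exact_mod_cast hS
  rw [rpow_three_halves]
  have hI' : c * (p * Real.sqrt p) ≤ p * I.card := by
    calc c * (p * Real.sqrt p) = p * (c * Real.sqrt p) := by ring
      _ ≤ p * I.card := mul_le_mul_of_nonneg_left hI hppos
  linarith

/-- **Converse of the Paley lift (rigidity of the parabola family).**  Let `P = {(x,y) : x + y² ∈ I}`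
be the union of the translates `x + y² = t`, `t ∈ I`, of a parabola.  If EVERY point of `P` has some
affine line through it (direction `d ≠ 0`, lines through the origin allowed) meeting `P` in that point
only, then `I` has no non-zero square difference.  With `paley_lift` this pins the family down: unions
of translated parabolas carry an induced point–line matching on all their points iff the parameter
set is a Paley coclique — the prime-field remnant of the (Buekenhout–Metz/Hermitian) unital, whose
parameter set is the subfield `𝔽_√q`. [elementary] -/
theorem paley_lift_converse (I : Finset (ZMod p))
    (h : ∀ x y : ZMod p, x + y ^ 2 ∈ I → ∃ d : ZMod p × ZMod p, d ≠ 0 ∧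
      ∀ s : ZMod p, (x + s * d.1) + (y + s * d.2) ^ 2 ∈ I → s = 0) :
    ∀ a ∈ I, ∀ b ∈ I, ∀ z : ZMod p, a - b = z ^ 2 → z = 0 := by
  intro a ha b hb z hz
  have hab : b + z ^ 2 = a := by linear_combination -hz
  obtain ⟨d, hd, hline⟩ := h b 0 (by simpa using hb)
  by_cases h2 : d.2 = 0
  · -- horizontal private line: it meets the parabola `a` at parameter `z²/d.1`
    have h1 : d.1 ≠ 0 := by
      intro h1
      exact hd (Prod.ext h1 h2)
    have := hline (z ^ 2 / d.1) (by
      rw [h2, mul_zero, add_zero, div_mul_cancel₀ _ h1, zero_pow two_ne_zero, add_zero, hab]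
      exact ha)
    rw [div_eq_zero_iff, or_iff_left h1] at this
    exact pow_eq_zero_iff (two_ne_zero) |>.mp this
  · -- a non-horizontal private line must be the parabola tangent (`d.1 = 0` at the point `(b,0)`) …
    have h1 : d.1 = 0 := by
      have := hline (-d.1 / d.2 ^ 2) (by
        have : b + -d.1 / d.2 ^ 2 * d.1 + (0 + -d.1 / d.2 ^ 2 * d.2) ^ 2 = b := by
          field_simp
          ring
        rw [this]
        exact hb)
      rw [div_eq_zero_iff, neg_eq_zero] at this
      exact this.resolve_right (pow_ne_zero 2 h2)
    -- … and the tangent meets the parabola `a = b + z²` at parameter `z/d.2`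
    have := hline (z / d.2) (by
      rw [h1, mul_zero, add_zero, zero_add, div_mul_cancel₀ _ h2, hab]
      exact ha)
    rw [div_eq_zero_iff] at this
    exact this.resolve_right h2


end Summit.MatrixMultiplication.MatrixMultiplication.Theorems.LevelOneGL2Designs.TangencyPaley
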